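import Summits.ABC.IUTFork.Joshi.ATS4Lem678Genuine
import HarnessLib

/-!
# [J-IV] Lemma 6.7.8 at the genuine `s^≤`: the room `log(4·e*_mod·ℓ) ≤ (4/3)ℓ` is AUTOMATIC under Theorem 6.1.1's standing prime
# `ℓ ≥ 29` for every `e*_mod` with `log(4·e*_mod) ≤ 35` — R-J census row Y-21g, E-cx-2 precision rider (kernel form)

Proof-only rider (0 defs) of the abc-iut cell, branch E / R-J «Joshi Y-discharge census» (rung LADDER-ABC:A2.RESCUE.J; D-0079), row Y-21g
of `HOME/plan/E/R-J/Y-CENSUS.tsv`; authored by the adversary lane abc-iut-E-cx-2 (gen 2) for abc-iut-E-t30's p453857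
`Joshi/ATS4Lem678Genuine.lean`, whose `TowerGlue.lem678_of_room` it composes with an elementary real inequality; to be filed by a prover
hand (E-t30 by name, E-plan 18:09:52Z) — the refuter lane cannot file under `Joshi/`.

WHY `ℓ ≥ 29` (print, recorded not asserted): Lemma 6.7.8 is stated «under the notations and assumptions of Theorem 6.1.1» ([J-IV]
arXiv:2403.10430v2 p.62); Theorem 6.1.1 takes «the prime number ℓ … provided by Theorem 5.7.1» (p.58 l.1–3), i.e. the prime of Lemma 5.8.7,
`Tate(C_λ)^{1/2} ≤ ℓ` (p.56 l.33–37), for `λ ∉ Exc`, where §5.8 puts every curve with `Tate^{1/2} ≤ ξ_prm` into `Exc` (p.54 l.19–24) and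
`ξ_prm ≥ 5` is any real with «(2/3)Q ≤ θ(Q) ≤ (4/3)Q for all Q ≥ ξ_prm» (Lemma 5.8.1 (1)); that property forces `ξ_prm ≥ 29`
(`(2/3)Q ≤ θ(Q)` fails for `Q ∈ (1.5·θ(23), 29) = (28.83…, 29)`, `θ(23) = log 223092870`). So `ℓ ≥ 29` there, and this file shows the
room — hence `Lem678` at the genuine `s^≤` — follows for every `e*_mod ≤ e^{35}/4` (`e*_mod = 2¹²·3³·5·e_mod`: every `e_mod ≤ 7·10⁸`).
FRAMING (binding): real-number statements about a TYPED reading predicate, PROVED. NO side is taken on [IUTchIII] Cor. 3.12 /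
[IUTchIV] Thm. 1.10, on Joshi's claims or on Mochizuki's report on them; NO abc claim; typed ≠ proved ≠ endorsed.
[claim: Joshi2024ATS4, status: disputed] for the locators only; the inequalities are [folklore].
-/

noncomputable section

namespace Summit.ABC.IUTFork.Joshi.ATS4

namespace LocusVolumeDatum

/-- **The room from `ℓ ≥ 29` and `log(4·e*_mod) ≤ 35`**: `log(4·e*_mod·ℓ) ≤ (4/3)·ℓ` (route: `log ℓ = log 29 + log(ℓ/29) ≤ 5·log 2 + ℓ/29 − 1`,
`log 2 < 0.6931471808`; at `ℓ = 29` the margin is `0.2`). PROVED. [folklore] -/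
theorem lem678Room_of_l_ge_29 (d : LocusVolumeDatum) (h29 : 29 ≤ d.l) (hE : Real.log (4 * d.estar) ≤ 35) :
    Real.log (4 * (d.estar * d.l)) ≤ 4 / 3 * d.l := by
  have hepos : 0 < d.estar := lt_of_lt_of_le (by norm_num) d.estar_ge
  have hl : (29 : ℝ) ≤ d.l := by exact_mod_cast h29
  have hlpos : (0 : ℝ) < d.l := by linarith
  have hsplit : Real.log (4 * (d.estar * d.l)) = Real.log (4 * d.estar) + Real.log d.l := by
    rw [show (4 : ℝ) * (d.estar * d.l) = (4 * d.estar) * d.l by ring, Real.log_mul (by positivity) hlpos.ne']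
  -- `log ℓ = log 29 + log (ℓ/29) ≤ log 29 + (ℓ/29 - 1)`
  have hdiv : Real.log (d.l : ℝ) = Real.log 29 + Real.log ((d.l : ℝ) / 29) := by
    rw [← Real.log_mul (by norm_num) (by positivity)]; congr 1; ring
  have htan : Real.log ((d.l : ℝ) / 29) ≤ (d.l : ℝ) / 29 - 1 := Real.log_le_sub_one_of_pos (by positivity)
  -- `log 29 ≤ log 32 = 5·log 2 < 5·0.6931471808`
  have h29le : Real.log (29 : ℝ) ≤ 5 * Real.log 2 := by
    rw [← Real.log_rpow (by norm_num : (0:ℝ) < 2), show ((2:ℝ) ^ (5:ℝ)) = 32 by norm_num]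
    exact Real.log_le_log (by norm_num) (by norm_num)
  have h2 : Real.log (2 : ℝ) < 0.6931471808 := Real.log_two_lt_d9
  rw [hsplit, hdiv]
  linarith

/-- `log(4·e*_mod) ≤ 35` for every `e*_mod ≤ 2¹²·3³·5·(7·10⁸)` (`e^{35} > 2.7182818283^{35} > 4·552960·7·10⁸`). PROVED. [folklore] -/
theorem log_four_mul_estar_le_35 (d : LocusVolumeDatum) (hE : d.estar ≤ 552960 * 700000000) :
    Real.log (4 * d.estar) ≤ 35 := by
  have hepos : 0 < d.estar := lt_of_lt_of_le (by norm_num) d.estar_ge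
  rw [Real.log_le_iff_le_exp (by positivity)]
  have h1 : (2.7182818283 : ℝ) < Real.exp 1 := Real.exp_one_gt_d9
  have h35 : (2.7182818283 : ℝ) ^ 35 < Real.exp 35 := by
    rw [show (35 : ℝ) = (35 : ℕ) * 1 by norm_num, Real.exp_nat_mul]
    exact pow_lt_pow_left₀ h1 (by norm_num) (by norm_num)
  have hnum : (4 : ℝ) * (552960 * 700000000) ≤ (2.7182818283 : ℝ) ^ 35 := by norm_num
  nlinarith

end LocusVolumeDatum

namespace PrimeTowerDatum.TowerGlue

variable {T : PrimeTowerDatum} {d : LocusVolumeDatum} (G : TowerGlue T d)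
include G

/-- **Lemma 6.7.8 at the genuine `s^≤` under Theorem 6.1.1's standing prime: `ℓ ≥ 29` and `log(4·e*_mod) ≤ 35` suffice** (E-t30's
`lem678_of_room` ∘ `lem678Room_of_l_ge_29`). PROVED. [claim: Joshi2024ATS4, status: disputed] (the reading predicate). -/
theorem lem678_of_l_ge_29 (hc : ∀ v : T.Pmod, (T.char v).Prime) (he : d.estar = (T.estar : ℝ)) (h29 : 29 ≤ d.l)
    (hE : Real.log (4 * d.estar) ≤ 35) : d.Lem678 :=
  G.lem678_of_room hc he (d.lem678Room_of_l_ge_29 h29 hE)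

/-- **… in E-t31's normal form `e*_mod = 2¹²·3³·5·e_mod`: `ℓ ≥ 29` and `e*_mod ≤ 552960·(7·10⁸)` suffice.** PROVED.
[claim: Joshi2024ATS4, status: disputed] (the reading predicate). -/
theorem lem678_of_l_ge_29_of_estar_le (hc : ∀ v : T.Pmod, (T.char v).Prime) (he : d.estar = (T.estar : ℝ)) (h29 : 29 ≤ d.l)
    (hE : d.estar ≤ 552960 * 700000000) : d.Lem678 :=
  G.lem678_of_l_ge_29 hc he h29 (d.log_four_mul_estar_le_35 hE)

end PrimeTowerDatum.TowerGlue

end Summit.ABC.IUTFork.Joshi.ATS4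

end
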